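import Mathlib.MeasureTheory.Integral.IntervalIntegral.FundThmCalculus
import Mathlib.Analysis.SpecialFunctions.Sqrt
import Literature.Geometry.Lorentzian.RadialCausalCone
import Literature.Geometry.Lorentzian.LorentzianDistance
import Literature.Geometry.Lorentzian.GeodesicSpeed
import Literature.Geometry.Lorentzian.LorentzianMetricProofs
import HarnessLib

/-!
# The twin paradox in a normal exponential chart: radial length bounds causal arc length
(O'Neill 1983, Ch. 5, Prop. 5.34 (2), chart form)

Let `(M, g, τ)` be a time-oriented Lorentzian manifold (Hausdorff, without boundary, smooth metric,
`∞ ≤ n`), `o ∈ M`, `exp_o : 𝓔_o → M` the exponential map of the Levi-Civita connection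
(`Literature.Geometry.Riemannian.expMap`) and, for a curve `β : [a, b] → 𝓔_o ⊆ T_oM = E`,
`α = exp_o ∘ β`. O'Neill 1983, Ch. 5, Prop. 5.34 (p. 147): *"(2) If `α` is a timelike curve in `𝒰`
from `p` to `q`, then `L(α) ≤ |σ|`"* (`σ` the radial geodesic), with the printed proof *"write
`α = exp_p ∘ β` … `r = |β|` … by the Gauss lemma `|α'| ≤ r'` … hence
`L(α) = ∫ |α'| ≤ ∫ r' = r(b) = |σ|"*. We prove, in this chart language:

* `LorentzianMetric.val_self_mul_val_velocity_le_sq` — **the Gauss-lemma inequality**: where `β t`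
  is timelike, `g_o(β,β) · g(α',α') ≤ g_o(β',β)²` (the radial vector `P = d(exp_o)_β(β)` is
  timelike with `g(P,P) = g_o(β,β)` and `g(α',P) = g_o(β',β)`, Gauss lemma; then reverse
  Cauchy–Schwarz for `P`).
* `LorentzianMetric.speed_expMap_comp_le` — hence for causal `α'`: `|α'| ≤ |g_o(β',β)| / |β|`
  (`|β| = √(-g_o(β,β))`), i.e. `|α'| ≤ r'` with `r = |β|`.
* `LorentzianMetric.arcLength_expMap_comp_le` — **`L(α|[a,b]) ≤ |β(b)| - |β(a)|`** when `α` is a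
  future causal curve and `β` stays in the future timecone on `[a, b]` (as it does as soon as
  `β(a)` is future timelike, O'Neill's Lemma 5.33 = `radial_timecone_invariance`): the speed bound
  integrated by the fundamental theorem of calculus for the monotone function `r`.
* `LorentzianMetric.arcLength_expMap_smul` — **the radial geodesic `s ↦ exp_o(sv)`, `s ∈ [0, 1]`,
  has length `|v| = √(-g_o(v,v))`** for causal `v ∈ 𝓔_o` (geodesics have constant speed).

The manifold statement — in a (uniformly) normal neighbourhood every causal curve from `p` to `q`
is at most as long as the radial geodesic — follows in `LocalTwinParadox.lean` by moving the base
point slightly to the past, exactly as for local closedness of `≤` (`LocalCausalClosedness.lean`).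
Everything is proved; no definitions and no named facts are introduced (D-0026).

## References

* B. O'Neill, *Semi-Riemannian geometry with applications to relativity*, Academic Press 1983,
  Ch. 5, Prop. 5.30 (p. 144), Lemma 5.33 and Prop. 5.34 (pp. 146–148), Cor. 5.2 and Lemma 5.1
  (Gauss lemma, p. 127). [ONeillSemiRiemannian1983]
* J. M. Lee, *Introduction to Riemannian Manifolds*, 2nd ed. (2018), Thm. 6.9 (Gauss lemma),
  Cor. 5.6 (constant speed). [LeeRiemannianManifolds2018]
-/

noncomputable section

open Bundle Set Filter Function MeasureTheory
open scoped Manifold ContDiff Topology ENNReal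

namespace Literature.Geometry.Lorentzian

open Literature.Geometry.Riemannian

variable {E : Type*} [NormedAddCommGroup E] [NormedSpace ℝ E] {H : Type*} [TopologicalSpace H]
  {I : ModelWithCorners ℝ E H} {M : Type*} [TopologicalSpace M] [ChartedSpace H M]
  [IsManifold I ∞ M]

namespace LorentzianMetric

variable {n : ℕ∞ω} {g : LorentzianMetric I n M}

variable [FiniteDimensional ℝ E] [CompleteSpace E] [T2Space M] [BoundarylessManifold I M]
  [g.HasLeviCivita] [CovariantDerivative.ContMDiffCovariantDerivative g.leviCivita 1]
  (τ : TimeOrientation g)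

/-! ### The Gauss-lemma inequality `|α'| ≤ r'` -/

/-- **The Gauss-lemma inequality** (O'Neill 1983, Ch. 5, proof of Prop. 5.34 (2)): for `β`
differentiable at `t` with `β t ∈ 𝓔_o` timelike and `α = exp_o ∘ β`,
`g_o(β t, β t) · g(α' t, α' t) ≤ g_o(β' t, β t)²`. Proof: the radial vector `P = d(exp_o)_{β t}(β t)`
satisfies `g(P, P) = g_o(β t, β t) < 0` (Gauss lemma) and `g(α' t, P) = g_o(β' t, β t)` (Gauss
lemma along the curve, `val_deriv_self_eq_val_velocity_radial`); apply reverse Cauchy–Schwarz to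
the timelike vector `P`. [cite: ONeillSemiRiemannian1983, Ch. 5, Prop. 5.34 (2) (pp. 147–148)] -/
theorem val_self_mul_val_velocity_le_sq (hn : (∞ : ℕ∞ω) ≤ n) (o : M) {β : ℝ → E} {β' : E}
    {t : ℝ} (hβ : HasDerivAt β β' t)
    (hmem : (β t : TangentSpace I o) ∈ expDomain g.leviCivita o)
    (htl : g.IsTimelike (x := o) (β t)) :
    g.val o (β t) (β t) *
        g.val (expMap g.leviCivita o (β t)) (velocity I (fun s ↦ expMap g.leviCivita o (β s)) t)
          (velocity I (fun s ↦ expMap g.leviCivita o (β s)) t) ≤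
      (g.val o β' (β t)) ^ 2 := by
  set P : TangentSpace I (expMap g.leviCivita o (β t)) :=
    velocity I (fun r : ℝ ↦ expMap g.leviCivita o ((r • β t : E) : TangentSpace I o)) 1 with hP_def
  set u : TangentSpace I (expMap g.leviCivita o (β t)) :=
    velocity I (fun s ↦ expMap g.leviCivita o (β s)) t with hu_def
  -- `g(P, P) = g_o(β t, β t)` (Gauss lemma with `w = v = β t`)
  have hPP : g.val (expMap g.leviCivita o (β t)) P P = g.val o (β t) (β t) := by
    have hG := gaussLemma g.toPseudoRiemannianMetric hn o hmem (β t : TangentSpace I o)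
    rw [← velocity_expMap_smul_one (cov := g.leviCivita) o hmem] at hG
    exact hG
  -- `g(u, P) = g_o(β', β t)` (Gauss lemma along the curve)
  have huP : g.val (expMap g.leviCivita o (β t)) u P = g.val o β' (β t) :=
    (val_deriv_self_eq_val_velocity_radial hn o hβ hmem).symm
  have hPt : g.IsTimelike (x := expMap g.leviCivita o (β t)) P := by
    show g.val (expMap g.leviCivita o (β t)) P P < 0
    rw [hPP]; exact htl
  have h := g.mul_le_sq_of_isTimelike_holds hPt u
  rw [hPP, g.symm _ P u, huP] at h
  exact h

/-- **`|α'| ≤ |g_o(β', β)| / |β|`** (O'Neill 1983, Ch. 5, proof of Prop. 5.34 (2): *"by the Gauss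
lemma … `|α'| ≤ r'`"*): for `β` differentiable at `t` with `β t ∈ 𝓔_o` timelike, if
`α = exp_o ∘ β` has causal velocity at `t` then its speed `√(-g(α', α'))` is at most
`|g_o(β' t, β t)| / √(-g_o(β t, β t))`. [cite: ONeillSemiRiemannian1983, Ch. 5, Prop. 5.34 (2) (pp. 147–148)] -/
theorem speed_expMap_comp_le (hn : (∞ : ℕ∞ω) ≤ n) (o : M) {β : ℝ → E} {β' : E} {t : ℝ}
    (hβ : HasDerivAt β β' t) (hmem : (β t : TangentSpace I o) ∈ expDomain g.leviCivita o)
    (htl : g.IsTimelike (x := o) (β t))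
    (hcausal : g.val (expMap g.leviCivita o (β t))
      (velocity I (fun s ↦ expMap g.leviCivita o (β s)) t)
      (velocity I (fun s ↦ expMap g.leviCivita o (β s)) t) ≤ 0) :
    g.speed (fun s ↦ expMap g.leviCivita o (β s)) t ≤
      |g.val o β' (β t)| / Real.sqrt (-g.val o (β t) (β t)) := by
  set Q := g.val o (β t) (β t) with hQ_def
  set A := g.val o β' (β t) with hA_def
  set G := g.val (expMap g.leviCivita o (β t))
      (velocity I (fun s ↦ expMap g.leviCivita o (β s)) t)
      (velocity I (fun s ↦ expMap g.leviCivita o (β s)) t) with hG_def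
  have hQ : Q < 0 := htl
  have hkey : Q * G ≤ A ^ 2 := val_self_mul_val_velocity_le_sq hn o hβ hmem htl
  have hsq : -G ≤ A ^ 2 / (-Q) := by
    rw [le_div_iff₀ (neg_pos.mpr hQ)]
    nlinarith [hkey]
  have hspeed : g.speed (fun s ↦ expMap g.leviCivita o (β s)) t = Real.sqrt (-G) :=
    PseudoRiemannianMetric.speed_eq_sqrt_neg_of_nonpos hcausal
  rw [hspeed]
  calc Real.sqrt (-G) ≤ Real.sqrt (A ^ 2 / (-Q)) := Real.sqrt_le_sqrt hsq
    _ = |A| / Real.sqrt (-Q) := by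
        rw [Real.sqrt_div (sq_nonneg A), Real.sqrt_sq_eq_abs]

/-! ### The twin paradox: integrated form -/

/-- **The twin paradox in the exponential chart** (O'Neill 1983, Ch. 5, Prop. 5.34 (2): *"`L(α) =
∫ |α'| ≤ ∫ r' = r(b)`"*): let `β : [a, b] → 𝓔_o` be differentiable with `α = exp_o ∘ β` a future
causal curve (future-directed causal velocities) and `β t` future timelike for every `t ∈ [a, b]`
(which holds as soon as `β a` is future timelike, `radial_timecone_invariance`). Then
`L(α|[a, b]) ≤ |β b| - |β a|`, `|v| = √(-g_o(v, v))`. Proof: `r = |β|` is differentiable with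
`r' = -g_o(β', β)/r ≥ 0` (`g_o(β', β) ≤ 0` by `radial_causalcone_antitone`) and `|α'| ≤ r'`
(`speed_expMap_comp_le`); integrate (fundamental theorem of calculus for the monotone `r`).
[cite: ONeillSemiRiemannian1983, Ch. 5, Prop. 5.34 (2) (pp. 147–148)] -/
theorem arcLength_expMap_comp_le (hn : (∞ : ℕ∞ω) ≤ n) {o : M} {β β' : ℝ → E} {a b : ℝ}
    (hab : a ≤ b) (hβ : ∀ t ∈ Icc a b, HasDerivAt β (β' t) t)
    (hdom : ∀ t ∈ Icc a b, (β t : TangentSpace I o) ∈ expDomain g.leviCivita o)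
    (hfut : ∀ t ∈ Icc a b,
      τ.IsFutureDirected (velocity I (fun s ↦ expMap g.leviCivita o (β s)) t))
    (htl : ∀ t ∈ Icc a b, g.IsTimelike (x := o) (β t) ∧ τ.IsFutureDirected (x := o) (β t)) :
    g.arcLength (fun s ↦ expMap g.leviCivita o (β s)) a b ≤
      ENNReal.ofReal (Real.sqrt (-g.val o (β b) (β b)) - Real.sqrt (-g.val o (β a) (β a))) := by
  haveI : Fact (1 ≤ n) := ⟨le_trans (by exact_mod_cast le_top) hn⟩
  rcases hab.eq_or_lt with rfl | hab'
  · rw [PseudoRiemannianMetric.arcLength_self]; exact bot_le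
  set α : ℝ → M := fun s ↦ expMap g.leviCivita o (β s) with hα_def
  set Q : ℝ → ℝ := fun t ↦ g.val o (β t) (β t) with hQ_def
  set A : ℝ → ℝ := fun t ↦ g.val o (β' t) (β t) with hA_def
  set r : ℝ → ℝ := fun t ↦ Real.sqrt (-Q t) with hr_def
  -- `g_o(β', β) ≤ 0` on `[a, b]`
  have hcone : ∀ t ∈ Icc a b, g.val o (β t) (β t) ≤ 0 ∧ g.val o (τ.vectorField o) (β t) ≤ 0 :=
    fun t ht ↦ ⟨le_of_lt (htl t ht).1, le_of_lt (htl t ht).2.2⟩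
  obtain ⟨hA, -⟩ := radial_causalcone_antitone τ hn hβ hdom hfut hcone
  have hQneg : ∀ t ∈ Icc a b, Q t < 0 := fun t ht ↦ (htl t ht).1
  -- `r` is differentiable with `r' = -A / r ≥ 0`
  have hr' : ∀ t ∈ Icc a b, HasDerivAt r (-A t / r t) t := by
    intro t ht
    have hQ' : HasDerivAt Q (2 * A t) t := hasDerivAt_val_self_comp o (hβ t ht)
    have h : HasDerivAt (fun s ↦ Real.sqrt (-Q s)) (-(2 * A t) / (2 * Real.sqrt (-Q t))) t :=
      (hQ'.neg).sqrt (neg_ne_zero.mpr (hQneg t ht).ne)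
    have heq : -(2 * A t) / (2 * Real.sqrt (-Q t)) = -A t / Real.sqrt (-Q t) := by
      rw [neg_mul_eq_mul_neg, mul_div_mul_left _ _ (two_ne_zero' ℝ)]
    rw [heq] at h
    exact h
  have hrpos : ∀ t ∈ Icc a b, 0 < r t := fun t ht ↦ Real.sqrt_pos.mpr (neg_pos.mpr (hQneg t ht))
  have hr'nn : ∀ t ∈ Icc a b, 0 ≤ -A t / r t := fun t ht ↦
    div_nonneg (neg_nonneg.mpr (hA t ht)) (hrpos t ht).le
  -- `|α'| ≤ r'`
  have hspeed : ∀ t ∈ Icc a b, g.speed α t ≤ -A t / r t := by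
    intro t ht
    have h := speed_expMap_comp_le hn o (hβ t ht) (hdom t ht) (htl t ht).1 (hfut t ht).1.1
    rwa [abs_of_nonpos (hA t ht)] at h
  -- fundamental theorem of calculus for the monotone function `r`
  have hcont : ContinuousOn r (Icc a b) := fun s hs ↦ (hr' s hs).continuousAt.continuousWithinAt
  have hint : IntegrableOn (fun s ↦ -A s / r s) (Ioc a b) :=
    intervalIntegral.integrableOn_deriv_of_nonneg hcont
      (fun s hs ↦ hr' s (Ioo_subset_Icc_self hs)) (fun s hs ↦ hr'nn s (Ioo_subset_Icc_self hs))
  have hFTC : ∫ s in Ioc a b, -A s / r s = r b - r a := by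
    rw [← intervalIntegral.integral_of_le hab]
    exact intervalIntegral.integral_eq_sub_of_hasDerivAt_of_le hab hcont
      (fun s hs ↦ hr' s (Ioo_subset_Icc_self hs))
      ((intervalIntegrable_iff_integrableOn_Ioc_of_le hab).2 hint)
  have hmono : g.arcLength α a b ≤ ∫⁻ s in Icc a b, ENNReal.ofReal (-A s / r s) := by
    rw [PseudoRiemannianMetric.arcLength_eq_lintegral_Icc]
    exact setLIntegral_mono' measurableSet_Icc fun s hs ↦ ENNReal.ofReal_le_ofReal (hspeed s hs)
  have hint' : Integrable (fun s ↦ -A s / r s) (volume.restrict (Ioc a b)) := hint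
  have hnn : 0 ≤ᵐ[volume.restrict (Ioc a b)] fun s ↦ -A s / r s :=
    ae_restrict_of_forall_mem measurableSet_Ioc fun s hs ↦ hr'nn s ⟨hs.1.le, hs.2⟩
  have heq : ∫⁻ s in Icc a b, ENNReal.ofReal (-A s / r s) = ENNReal.ofReal (r b - r a) := by
    rw [← restrict_Ioc_eq_restrict_Icc, ← ofReal_integral_eq_lintegral_ofReal hint' hnn, hFTC]
  calc g.arcLength α a b ≤ ∫⁻ s in Icc a b, ENNReal.ofReal (-A s / r s) := hmono
    _ = ENNReal.ofReal (r b - r a) := heq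

/-- **The twin paradox in the exponential chart, started in the timecone**: if `β a` is future
timelike then `L(exp_o ∘ β|[a, b]) ≤ |β b| - |β a| ≤ |β b|` for a future causal `exp_o ∘ β`
(O'Neill 1983, Ch. 5, Lemma 5.33 keeps `β` in the timecone, then `arcLength_expMap_comp_le`).
[cite: ONeillSemiRiemannian1983, Ch. 5, Prop. 5.34 (2) (pp. 147–148)] -/
theorem arcLength_expMap_comp_le_of_isTimelike (hn : (∞ : ℕ∞ω) ≤ n) {o : M} {β β' : ℝ → E}
    {a b : ℝ} (hab : a ≤ b) (hβ : ∀ t ∈ Icc a b, HasDerivAt β (β' t) t)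
    (hdom : ∀ t ∈ Icc a b, (β t : TangentSpace I o) ∈ expDomain g.leviCivita o)
    (hfut : ∀ t ∈ Icc a b,
      τ.IsFutureDirected (velocity I (fun s ↦ expMap g.leviCivita o (β s)) t))
    (hat : g.IsTimelike (x := o) (β a)) (haf : τ.IsFutureDirected (x := o) (β a)) :
    g.arcLength (fun s ↦ expMap g.leviCivita o (β s)) a b ≤
      ENNReal.ofReal (Real.sqrt (-g.val o (β b) (β b))) := by
  obtain ⟨htl, -⟩ := radial_timecone_invariance τ hn hβ hdom hfut hat haf
  refine (arcLength_expMap_comp_le τ hn hab hβ hdom hfut htl).trans (ENNReal.ofReal_le_ofReal ?_)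
  linarith [Real.sqrt_nonneg (-g.val o (β a) (β a))]

/-! ### The length of a radial geodesic -/

/-- **The radial geodesic `s ↦ exp_o(sv)` on `[0, 1]` has length `|v| = √(-g_o(v, v))`** for causal
`v ∈ 𝓔_o` (geodesics have constant speed `|γ_v'| = |v|`, O'Neill 1983, Ch. 3, p. 69; hence
`L(γ_v|[0,1]) = |v|`, Ch. 5, Prop. 5.34: *"`r(b) = |σ|`"*).
[cite: ONeillSemiRiemannian1983, Ch. 5, Prop. 5.34 (p. 147)] -/
theorem arcLength_expMap_smul (hn : (∞ : ℕ∞ω) ≤ n) (o : M) {v : TangentSpace I o}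
    (hv : v ∈ expDomain g.leviCivita o) (hvc : g.val o v v ≤ 0) :
    g.arcLength (fun s : ℝ ↦ expMap g.leviCivita o (s • v)) 0 1 =
      ENNReal.ofReal (Real.sqrt (-g.val o v v)) := by
  haveI : Fact (1 ≤ n) := ⟨le_trans (by exact_mod_cast le_top) hn⟩
  obtain ⟨hmax, h0, hγ0, hγv⟩ := maximalGeodesic_spec' (cov := g.leviCivita) o v
  set γ := maximalGeodesic g.leviCivita o v with hγ_def
  set D := maximalGeodesicDomain g.leviCivita o v with hD_def
  have h1 : (1 : ℝ) ∈ D := hv.2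
  have hsub : Icc (0 : ℝ) 1 ⊆ D := hmax.2.1.out h0 h1
  -- constant speed: `g(γ', γ') = g_o(v, v)` on `D`
  have hconst : ∀ t ∈ D, g.val (γ t) (velocity I γ t) (velocity I γ t) = g.val o v v := by
    intro t ht
    have h := g.toPseudoRiemannianMetric.val_velocity_eq_of_isGeodesicOn_holds hmax.isOpen
      hmax.2.1 hmax.isGeodesicOn ht h0
    rw [hγv, hγ0] at h
    exact h
  -- the radial curve agrees with `γ` on `[0, 1]`
  have heq : EqOn (fun s : ℝ ↦ expMap g.leviCivita o (s • v)) γ (Icc 0 1) := fun s hs ↦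
    (expMap_smul_of_mem (cov := g.leviCivita) o v (hsub hs)).2
  rw [PseudoRiemannianMetric.arcLength_congr heq]
  have hspeed : ∀ t ∈ Icc (0 : ℝ) 1, g.speed γ t = Real.sqrt (-g.val o v v) := by
    intro t ht
    rw [PseudoRiemannianMetric.speed_eq_sqrt_neg_of_nonpos (by rw [hconst t (hsub ht)]; exact hvc),
      hconst t (hsub ht)]
  rw [PseudoRiemannianMetric.arcLength_eq_of_speed_eq zero_le_one hspeed, sub_zero, mul_one]

end LorentzianMetric

end Literature.Geometry.Lorentzian

end
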